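import Summits.HodgeConjecture.HodgeConjecture.Theses.EndoscopicMiddleDegree
import Literature.AlgebraicGeometry.ShimuraVarieties.HeckeCorrespondenceAction
import Literature.AlgebraicGeometry.HodgeTheory.LefschetzOneOne
import Literature.AlgebraicGeometry.HodgeTheory.AbsoluteHodgeClasses

/-!
# Line `hecke-simple-seed-amplification` for crux `EndoscopicMiddleDegree.BallQuotientHodgeAbsolute` (stmt-HodgeConjecture-14348)

Skeleton (crux-plan, planner-cruxplan-stmt-HodgeConjecture-14348-hecke-simple-seed-am-0, 2026-08-16) of
idea card `Cruxes/BallQuotientHodgeAbsolute/Ideas/hecke-simple-seed-amplification.md` (crux-ideate r1,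
ideator 1; triage r1-1 / r1-2 / r1-3: **pass ×3**, sharpenings built in below and listed in the line card
`Lines/hecke-simple-seed-amplification.md`, § Triage answers).

STATUS NOTE (2026-08-16T03:25Z). This file was `lean check`ed rc 0 four times (02:28–02:34Z) against
route revisions ≤ 3, in which `BallQuotientHodgeAbsolute` was item stmt-HodgeConjecture-14348 of
`Theses/EndoscopicMiddleDegree.lean`, the concluding theorem `BallQuotientHodgeAbsolute_of` auditing as
proof-of-item BY NAME. At route rev 4 (03:06Z, promote-to-A step 1/2) the crux was DROPPED from the
route as not load-bearing and its decl removed from the route file (item closed), while this seat was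
retrying the farm-publication of the file (strict lane incoherent 02:30–03:20Z under revs 3–5). So that
the line stays checkable and re-attachable, the dropped decl is restated below VERBATIM as the local
`BallQuotientHodgeAbsolute` (same namespace-free text as rev 3; if the item is ever re-wanted, delete
the local copy and the file concludes the route decl again). Everything else is unchanged, and the
corollary `middleDegreeStep_of_stubs : MiddleDegreeStep` still concludes the route's LIVE TARGET
(stmt-HodgeConjecture-14346) by name from the same six stubs.

THE CRUX (verbatim, rank 3 of route EndoscopicMiddleDegree until rev 3; `m` UNRESTRICTED): for every `m`, every
`X` carrying a `UnitaryBallQuotientDatum (2(m+1)) X` (`X(ℂ) ≅ Γ\𝔹²ⁿ`, `n = m + 1`) and every RATIONAL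
class `c ∈ H²ⁿ(X(ℂ); ℂ)` of Hodge type `(n,n)`: `IsAbsoluteHodgeClass (2n) X n c`.

THE LINE (one algebraic seed per simple ℚ-Hecke module; the ALGEBRAIC-seed form endorsed by triage
r1-2, so that "cycle classes are absolute Hodge" is invoked ONCE at the end — Disproof §2's
`of_middleHodge` shape — and the chart-comparison facts `hadd`/`hzero` of the card's first lemma
(Disproof §8, finding 10) never arise). Write `H := H²ⁿ(X(ℂ); ℂ)`, `T_g := D.heckeCorrespondenceAction (2n) g`
(the tree's GENUINE Hecke operator `[Γ∩g⁻¹Γg : N_g]⁻¹ · τ ∘ π_g^*`, file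
`ShimuraVarieties/HeckeCorrespondenceAction`; `T_g` preserves rational classes —
`isRationalClass_heckeCorrespondenceAction`, PROVED there), `Hdg := hodgeSpan m X` = the `ℂ`-span of the
rational `(n,n)`-classes, `Alg := algebraicClasses X n`.
* A `ℂ`-subspace `M ≤ H` is HECKE-STABLE if `T_g M ≤ M` for all `g` (`IsHeckeStable`), DEFINED OVER `ℚ`
  if it is spanned by its rational classes (`IsRationalSubspace`), and a SIMPLE PIECE
  (`IsSimplePiece`: a simple `ℚ`-Hecke submodule of `Hdg`) if it is a minimal non-zero Hecke-stable
  `ℚ`-defined subspace of `Hdg`. Its ISOTYPIC HULL (`isotypicHull`: the sum of the images of `M` under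
  the commutant of the `T_g`) is, by the double-commutant theorem, the sum of the full Hecke-isotypic
  components `H[τπ_f]` of `H` over the `Aut(ℂ)`-orbit `{τπ_f}` of finite parts underlying `M` — the
  RATIONAL PACKET of `M` in degree `2n` (no `σ`-conjugation needed: rationality of `M` runs over the orbit
  by itself). `M` is of PURE TYPE (`IsPureType`) if its packet is entirely of type `(n,n)` — the card's /
  triage X2–X3's "pure ((n,n)-only in degree 2n) packet", automorphically: every cohomological partner
  `A(a,b) ⊗ L^k` (`a+b+2k = 2n`) of every `τπ_f` is diagonal, `a = b`.
* `stub_heckeCorrespondence` (KNOWN: BMM Thm 61 / Part 2 §1.8, `ℋ_K` acts by ALGEBRAIC correspondences):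
  `T_g` preserves Hodge types and algebraic classes.
* `stub_semisimple` (KNOWN: `H` is finite-dimensional, `T_g^* = T_{g⁻¹}` for the Hodge metric, so the
  Hecke algebra is semisimple over `ℚ`): a proper Hecke-stable `ℚ`-defined `S < Hdg` misses a simple piece.
* `stub_multiplicityOne` (MultOne, the line's structural bet; Mok arXiv:1206.0882 Thm 2.5.2 / KMSW
  arXiv:1409.3731, AJ = Arthur packets multiplicity-free arXiv:1507.01432, one diagonal member per
  Adams–Johnson packet; RISK: the CLASSICAL level-`Γ` Hecke algebra vs self-twists, triage r1-1): `Hdg` is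
  multiplicity-free — a rational `(n,n)`-class of the packet of a simple piece lies in the piece.
* `stub_seedPerPacket` (BET 1 = the heart's non-vanishing; theta / Kudla–Millson / GGP): the packet of a
  PURE simple piece contains a non-zero rational ALGEBRAIC class.
* `stub_coreVanishing` (BET 2, the shared residue; HARDEST): every simple piece is of pure type — impure
  packets (killed ones: free by the sibling sieve; genuine cores: open) carry no rational `(n,n)`-class.
* `stub_cycleClassesAbsoluteHodge` (KNOWN in print: Deligne 1982 Ex. 2.1(a), Charles–Schnell §11.2.2;
  tree-blocked on `ConjugationChart` existence, Disproof §6): rational `(p,p)` algebraic classes are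
  absolute Hodge (verbatim Disproof's `CycleClassesAbsoluteHodge` / the inline hypothesis `hAH` of the
  landed `Negative/HodgeImpliesAbsoluteHodge.lean`).
* COMPOSITION (kernel-checked, `middleHodge_of_stubs` + `BallQuotientHodgeAbsolute_of`): let
  `S := span{rational (n,n) algebraic classes} ≤ Hdg`; `S` is Hecke-stable (rationality: tree theorem;
  type + algebraicity: `stub_heckeCorrespondence`) and `ℚ`-defined by construction. If `S ≠ Hdg`,
  `stub_semisimple` gives a simple piece `M` with `M ⊓ S = ⊥`; `stub_coreVanishing` makes it pure;
  `stub_seedPerPacket` gives a rational algebraic `a ≠ 0` in its packet, of type `(n,n)` by purity;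
  `stub_multiplicityOne` puts `a` in `M`; but `a ∈ S` — so `a ∈ M ⊓ S = ⊥`, contradiction. Hence
  `Hdg = S ≤ Alg` (middle-degree HC on the family, Disproof's `MiddleHodge`, ALL `m`), and
  `stub_cycleClassesAbsoluteHodge` concludes the crux BY NAME. The AMPLIFICATION is the step
  "one seed `a` ⟹ the whole piece": `Alg ∩ M` is a non-zero `ℚ`-Hecke submodule of the simple `M`.

Calibration `m = 0` (compact 2-ball quotients, degree 2; Disproof §3): every stub is a theorem in print —
MultOne is Rogawski's multiplicity one for `U(3)`, SeedPerPacket is Lefschetz `(1,1)`, CoreVanishing is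
Blasius–Rogawski (zbl:0828.14012: the impure endoscopic packets `{A(2,0),A(1,1)} / {A(1,1),A(0,2)}` carry no
rational `(1,1)`-line, by Lefschetz + irreducibility) — the card's "free consistency at n = 1".

Disproof.lean (cycles 1–2, NO KILL; landed `Theorems/BallQuotientHodgeAbsolute/Negative/
HodgeImpliesAbsoluteHodge.lean` p73087 and `…/ChartConjugationUniqueness.lean`, both importable): NO
`_false_without_<H>` theorem, no tightness lemma, no refuted strengthening, so no stub here can be an
instance of a landed Negative lemma (checked: the Negative file's theorems are read-backs, `¬HC`-transfers
and chart calculus; none has the shape of a stub below). Honoured: §2 (`of_middleHodge` shape = this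
composition); §4 (rationality load-bearing: `Hdg`, `IsRationalSubspace`, MultOne and the seed are all
statements about RATIONAL classes — drop rationality and `stub_multiplicityOne` is false, conjugate pieces
having equal dimension); §8 finding 10 (`hadd`/`hzero` are comparison facts ⟹ this skeleton amplifies
ALGEBRAIC classes, a `Submodule`, and meets `IsAbsoluteHodgeClass` only in the last stub); §9 (étale
component: an algebraic seed makes the whole pure packet algebraic, hence genuinely Tate — what route
step B2b wanted). Negatives index (`ledger negatives --problem HodgeConjecture`: stmt-12555 ELineTransport
matrix identity, stmt-11121 Fermat–K3 multiset exhaustion): unrelated shapes.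
-/

noncomputable section

namespace Summit.HodgeConjecture.HodgeConjecture.Cruxes.BallQuotientHodgeAbsolute.HeckeSimpleSeedAmplification

open Literature.AlgebraicGeometry.Motives (SchemeOver ComplexPoints IsSmoothProjective)
open Literature.AlgebraicGeometry.HodgeTheory
open Literature.AlgebraicGeometry.ShimuraVarieties
open Summit.HodgeConjecture.HodgeConjecture.Theses.EndoscopicMiddleDegree

set_option linter.unusedVariables false
set_option linter.dupNamespace false

variable {p : ℕ} {X : SchemeOver ℂ}

/-! ## The crux, verbatim (local copy — see STATUS NOTE in the module docstring) -/

/-- **The crux `BallQuotientHodgeAbsolute`** — VERBATIM the decl of item stmt-HodgeConjecture-14348 as it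
stood in `Theses/EndoscopicMiddleDegree.lean` through route rev 3 (dropped from the route file at rev 4,
2026-08-16T03:06Z): every rational Hodge class in the middle degree of an even-dimensional compact
arithmetic ball quotient is an absolute Hodge class. Restated here only so that this line file keeps
elaborating after the drop; it is NOT a new statement and carries no obligation tag. -/
def BallQuotientHodgeAbsolute : Prop :=
  ∀ (m : ℕ) (X : Literature.AlgebraicGeometry.Motives.SchemeOver ℂ), Nonempty (Literature.AlgebraicGeometry.ShimuraVarieties.UnitaryBallQuotientDatum (2 * (m + 1)) X) → ∀ c : Literature.AlgebraicGeometry.HodgeTheory.complexBetti X (2 * (m + 1)), Literature.AlgebraicGeometry.HodgeTheory.IsRationalClass c → Literature.AlgebraicGeometry.HodgeTheory.IsOfHodgeType (2 * (m + 1)) X (2 * (m + 1)) (m + 1) (m + 1) c → Literature.AlgebraicGeometry.HodgeTheory.IsAbsoluteHodgeClass (2 * (m + 1)) X (m + 1) c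

/-! ## Vocabulary: Hecke-stable and `ℚ`-defined subspaces, the Hodge span, simple pieces, packets -/

/-- `M ≤ Hᵏ(X(ℂ); ℂ)` is **Hecke-stable** for the datum `D` (`X(ℂ) ≅ Γ\𝔹ᵖ`): every Hecke operator
`T_g = D.heckeCorrespondenceAction k g` (`g ∈ GL_{p+1}(E)`; the genuine `T_{ΓgΓ}` for admissible
`g ∈ U(V)(F)`, the junk value `0` otherwise — harmless) maps `M` into itself. -/
def IsHeckeStable (D : UnitaryBallQuotientDatum p X) {k : ℕ} (M : Submodule ℂ (complexBetti X k)) : Prop :=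
  ∀ g : GL (Fin (p + 1)) D.E, M.map (D.heckeCorrespondenceAction k g) ≤ M

/-- `M ≤ Hᵏ(X(ℂ); ℂ)` is **defined over `ℚ`**: it is spanned by its rational classes
(`M = (M ∩ Hᵏ(X; ℚ)) ⊗ ℂ` inside `Hᵏ(X; ℂ) = Hᵏ(X; ℚ) ⊗ ℂ`). -/
def IsRationalSubspace {k : ℕ} (M : Submodule ℂ (complexBetti X k)) : Prop :=
  M ≤ Submodule.span ℂ {x | x ∈ M ∧ IsRationalClass x}

/-- The **Hodge span** of the middle degree of the `2(m+1)`-fold `X`: the `ℂ`-span `Hdg` of the RATIONAL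
classes of Hodge type `(m+1, m+1)` in `H^{2(m+1)}(X(ℂ); ℂ)` — exactly the classes the crux quantifies
over (`= Hdg^{n,n}(X, ℚ) ⊗ ℂ`; defined as a span because `IsOfHodgeType`, an `∃` over Hodge models, is
not formally additive in the tree, Disproof §8 finding 10). -/
def hodgeSpan (m : ℕ) (X : SchemeOver ℂ) : Submodule ℂ (complexBetti X (2 * (m + 1))) :=
  Submodule.span ℂ {x | IsRationalClass x ∧
    IsOfHodgeType (2 * (m + 1)) X (2 * (m + 1)) (m + 1) (m + 1) x}

/-- `M` is a **simple piece** (a simple `ℚ`-Hecke submodule of the rational middle Hodge classes): a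
non-zero Hecke-stable `ℚ`-defined subspace of the Hodge span, minimal among such. With multiplicity one
(`stub_multiplicityOne`) these are exactly the Hodge parts `Hdg ∩ (⊕_τ H[τπ_f])` of the rational Hecke
packets meeting `Hdg` (the card's `Hdg(π_f)`, orbit `{τπ_f}` of one finite part under `Aut ℂ`). -/
def IsSimplePiece (m : ℕ) (D : UnitaryBallQuotientDatum (2 * (m + 1)) X)
    (M : Submodule ℂ (complexBetti X (2 * (m + 1)))) : Prop :=
  M ≤ hodgeSpan m X ∧ M ≠ ⊥ ∧ IsHeckeStable D M ∧ IsRationalSubspace M ∧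
    ∀ M' : Submodule ℂ (complexBetti X (2 * (m + 1))),
      M' ≤ M → IsHeckeStable D M' → IsRationalSubspace M' → M' = ⊥ ∨ M' = M

/-- The **isotypic hull** (the PACKET) of `M ≤ Hᵏ(X(ℂ); ℂ)`: the sum of the images `φ(M)` over all
endomorphisms `φ` commuting with every Hecke operator. For the (semisimple) Hecke algebra acting on the
finite-dimensional `H`, the double-commutant theorem identifies it with the sum of the Hecke-isotypic
components of `H` of the types occurring in `M`; for a simple piece `M` of type `{τπ_f}_τ` this is
`⊕_τ H^{k}[τπ_f] = ⊕_τ ⊕_{π_∞} Hᵏ(𝔤,K; π_∞) ⊗ m(π_∞ ⊗ τπ_f) · (τπ_f)^{K}` (Matsushima), all partners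
`π_∞` in degree `k` included. -/
def isotypicHull (D : UnitaryBallQuotientDatum p X) {k : ℕ} (M : Submodule ℂ (complexBetti X k)) :
    Submodule ℂ (complexBetti X k) :=
  ⨆ (φ : Module.End ℂ (complexBetti X k))
    (_ : ∀ g : GL (Fin (p + 1)) D.E,
      φ ∘ₗ D.heckeCorrespondenceAction k g = D.heckeCorrespondenceAction k g ∘ₗ φ),
    M.map φ

/-- `M` is of **pure type**: every class of its packet (isotypic hull) in the middle degree is of Hodge
type `(m+1, m+1)`. Automorphically (Matsushima + Vogan–Zuckerman for `U(2n,1)`, `n = m+1`): every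
cohomological partner `A(a,b) ⊗ Lᵏ`, `a + b + 2k = 2n`, of every `τπ_f` in the orbit is DIAGONAL
(`a = b`) — the Tate-type / character packets of the card and of triage X3; its negation covers both the
KILLED packets of the sibling line `conjugate-dimension-sieve` (some conjugate has no `(n,n)` at all) and
the genuine CORES (a constituent of dimension `≥ 2` owns the middle coordinate). -/
def IsPureType (m : ℕ) (D : UnitaryBallQuotientDatum (2 * (m + 1)) X)
    (M : Submodule ℂ (complexBetti X (2 * (m + 1)))) : Prop :=
  ∀ x ∈ isotypicHull D M, IsOfHodgeType (2 * (m + 1)) X (2 * (m + 1)) (m + 1) (m + 1) x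

/-! ### Sanity lemmas on the vocabulary (proved) -/

/-- A subspace lies in its packet (`φ = id` commutes with everything). -/
theorem le_isotypicHull (D : UnitaryBallQuotientDatum p X) {k : ℕ} (M : Submodule ℂ (complexBetti X k)) :
    M ≤ isotypicHull D M := by
  unfold isotypicHull
  have h : M.map (LinearMap.id : Module.End ℂ (complexBetti X k)) ≤
      ⨆ (φ : Module.End ℂ (complexBetti X k))
        (_ : ∀ g : GL (Fin (p + 1)) D.E,
          φ ∘ₗ D.heckeCorrespondenceAction k g = D.heckeCorrespondenceAction k g ∘ₗ φ),
        M.map φ :=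
    le_iSup₂_of_le (LinearMap.id : Module.End ℂ (complexBetti X k))
      (fun g => by rw [LinearMap.id_comp, LinearMap.comp_id]) le_rfl
  rwa [Submodule.map_id] at h

/-- The packet of a Hecke-stable subspace is Hecke-stable (`T_g φ(M) = φ(T_g M) ≤ φ(M)`). -/
theorem isHeckeStable_isotypicHull (D : UnitaryBallQuotientDatum p X) {k : ℕ}
    {M : Submodule ℂ (complexBetti X k)} (hM : IsHeckeStable D M) :
    IsHeckeStable D (isotypicHull D M) := by
  intro g
  unfold isotypicHull
  rw [Submodule.map_iSup]
  refine iSup_le fun φ => ?_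
  rw [Submodule.map_iSup]
  refine iSup_le fun hφ => ?_
  rw [← Submodule.map_comp, ← hφ g, Submodule.map_comp]
  exact le_iSup₂_of_le φ hφ (Submodule.map_mono (hM g))

/-- Every rational `(m+1,m+1)`-class — the subject of the crux — lies in the Hodge span. -/
theorem mem_hodgeSpan {m : ℕ} {c : complexBetti X (2 * (m + 1))} (hc : IsRationalClass c)
    (hH : IsOfHodgeType (2 * (m + 1)) X (2 * (m + 1)) (m + 1) (m + 1) c) : c ∈ hodgeSpan m X :=
  Submodule.subset_span ⟨hc, hH⟩

/-- The Hodge span is defined over `ℚ` (by construction). -/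
theorem isRationalSubspace_hodgeSpan (m : ℕ) (X : SchemeOver ℂ) : IsRationalSubspace (hodgeSpan m X) :=
  Submodule.span_mono fun x hx => ⟨Submodule.subset_span hx, hx.1⟩

/-! ## The stubs -/

/-- **Stub 1 — Hecke operators are induced by ALGEBRAIC correspondences (KNOWN).** For every compact
ball quotient datum `D : UnitaryBallQuotientDatum p X` and every `g`, the Hecke operator `T_g` on
`H•(X(ℂ); ℂ)` (i) preserves Hodge types `(a,b)` in every degree and (ii) maps algebraic classes of every
codimension `q` to algebraic classes. Why plausibly true: `T_g = [Γ' : N_g]⁻¹ · π_* π_g^*` for the two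
finite étale projections `π, π_g : N_g\𝔹 ⇉ Γ\𝔹 = X(ℂ)` of the Hecke correspondence, which is an
ALGEBRAIC correspondence on `X × X` (Baily–Borel / canonical models; BMM arXiv:1306.1515 Part 2 §1.8
"the Hecke algebra `ℋ_K` acts as algebraic correspondences on `S(K)`", Thm 61: the pieces are `ℚ`-sub-Hodge
structures; Shimura 1971 Ch. 7): pull-back and push-forward along finite morphisms of smooth projective
varieties are morphisms of Hodge structures (of type `(0,0)`) and carry cycles to cycles (Fulton Ch. 1,
§16.1), and `N^q H^{2q}` (the tree's `algebraicClasses` = classes supported in codimension `q`) is stable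
under `π_* π_g^*` because Hecke translates of a Zariski-closed `Z` of codimension `≥ q` are Zariski closed
of codimension `≥ q`. For non-admissible `g` the operator is `0` (both clauses trivial). Size L (needs the
algebraic structure of the level covers / algebraicity of Hecke translates; the Hodge clause also needs
model-independence of `H^{p,q}`, fact `hodgePQ_independent_of_hodgeModel`). -/
theorem stub_heckeCorrespondence :
    ∀ (p : ℕ) (X : SchemeOver ℂ) (D : UnitaryBallQuotientDatum p X) (g : GL (Fin (p + 1)) D.E),
      (∀ (k a b : ℕ) (x : complexBetti X k),
        IsOfHodgeType p X k a b x → IsOfHodgeType p X k a b (D.heckeCorrespondenceAction k g x)) ∧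
      (∀ q : ℕ, (algebraicClasses X q).map (D.heckeCorrespondenceAction (2 * q) g) ≤
        algebraicClasses X q) := by
  sorry

/-- **Stub 2 — semisimplicity of the rational middle Hodge classes as a `ℚ`-Hecke module (KNOWN).**
For a `2(m+1)`-dimensional datum: if `S` is a Hecke-stable, `ℚ`-defined subspace of the Hodge span `Hdg`
with `S ≠ Hdg`, then some SIMPLE PIECE `M` of `Hdg` meets `S` trivially. Why plausibly true:
`H = H^{2n}(X(ℂ); ℂ) = H^{2n}(X; ℚ) ⊗ ℂ` is finite-dimensional (compact manifold); `Hdg_ℚ := Hdg ∩ H(ℚ)`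
is a finite-dimensional module over the `ℚ`-algebra `A_ℚ = ℚ⟨T_g⟩`; `A_ℚ ⊗ ℂ` is closed under the
adjoint for the (positive definite) Hodge inner product on harmonic forms — `T_g^* = T_{g⁻¹}`, the
transpose of the Hecke correspondence, and `T_g` commutes with the Weil operator because `π`, `π_g` are
local isometries for the Bergman metric — hence semisimple, hence so is `A_ℚ`; so `S_ℚ` has an
`A_ℚ`-stable complement `C_ℚ ≠ 0` in `Hdg_ℚ`, which contains a simple submodule `M_ℚ`, and
`M := M_ℚ ⊗ ℂ` is a simple piece with `M ∩ S = (M_ℚ ∩ S_ℚ) ⊗ ℂ = 0` (flat base change; a Hecke-stable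
`ℚ`-defined `M' ≤ M` has `M'_ℚ` an `A_ℚ`-submodule of `M_ℚ`). Vacuous if `X` had no Hodge model
(`Hdg = ⊥`). Size L (finite-dimensionality of `complexBetti` of a smooth projective `X`, the `ℚ`-structure
`H = H(ℚ) ⊗ ℂ` on `IsRationalClass`, and the Hodge-metric adjoint of the tree's transfer). Leans on:
`isRationalClass_heckeCorrespondenceAction`, `stub_heckeCorrespondence` (i), `IsSemisimpleModule`,
`FiniteDeckCover.transferMap`, `HodgeModel`. -/
theorem stub_semisimple :
    ∀ (m : ℕ) (X : SchemeOver ℂ) (D : UnitaryBallQuotientDatum (2 * (m + 1)) X)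
      (S : Submodule ℂ (complexBetti X (2 * (m + 1)))),
      S ≤ hodgeSpan m X → IsHeckeStable D S → IsRationalSubspace S → S ≠ hodgeSpan m X →
        ∃ M : Submodule ℂ (complexBetti X (2 * (m + 1))), IsSimplePiece m D M ∧ M ⊓ S = ⊥ := by
  sorry

/-- **Stub 3 — MULTIPLICITY ONE (the line's structural bet; card fact (a) + (b)).** For a simple piece
`M` of the Hodge span of a `2n`-dimensional datum (`n = m+1`), every RATIONAL `(n,n)`-class of the packet
(isotypic hull) of `M` already lies in `M`: the rational middle Hodge classes form a MULTIPLICITY-FREE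
`ℚ`-Hecke module, `Hdg_ℚ[V] = M_ℚ` for the simple type `V` of `M`. Why plausibly true:
`(Hdg ∩ isotypicHull M) = ⊕_τ (Hdg-part of H[τπ_f])` and the `(n,n)`-part of `H^{2n}[τπ_f]` is
`⊕_{a} H^{n,n}(𝔤,K; A(a,a) ⊗ L^{n-a}) ⊗ m(A(a,a) ⊗ τπ_f) · (τπ_f)^K` with each `H^{n,n}(𝔤,K; ·)`
one-dimensional; (1) `τπ_f` determines the global parameter `ψ` (strong multiplicity one for `GL_{2n+1}/E`
after base change), (2) an Adams–Johnson packet `Π_{ψ_∞}` contains AT MOST ONE diagonal member `A(a,a)`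
(BMM arXiv:1306.1515 §4.3 after Cossutta, p. 54: `A_𝔮` with blocks `μ_j ⊠ R_{m_j}` ordered by
`k_j = -Σ_{l<j} m_l + Σ_{l>j} m_l` has `(a,b) = (mass above, mass below)` the non-compact block, and two
balanced positions are impossible) and AJ packets are multiplicity-free sets (Arancibia–Mœglin–Renard
arXiv:1507.01432), (3) `m_ψ(π) ≤ 1` (Mok arXiv:1206.0882 Thm 2.5.2; inner forms: KMSW arXiv:1409.3731) —
so `Hdg ∩ H[τπ_f] ≅ (τπ_f)^K` or `0` as a Hecke module, and `Aut ℂ`-transitivity on the orbit (card fact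
(b): a Galois-stable set of `τ`'s is `∅` or the orbit, RATIONALITY used here) makes `Hdg ∩ isotypicHull M`
simple, `= M`. WHY IT MIGHT FAIL (triage r1-1 / r1-3, card falsifier (a), sharpened): the operators
generate the CLASSICAL Hecke algebra `ℋ(Γ, U(V)(F)) ≅ ℋ(K\G¹/K)`, `G¹ = G(ℚ)K = det⁻¹(U₁(F)·det K)` (strong
approximation for `SU(V)`), which sees `π_f` only through `π_f|_{G¹}`: twist-partners `π_f ⊗ χ∘det`
(`χ` a character of the component group `G(𝔸_f)/G¹`, `χ_∞ = 1`) are HARMLESS — they cut out the same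
piece of `H²ⁿ(Γ\𝔹)` — but a SELF-TWIST group `{χ : π_f ⊗ χ∘det ≅ π_f}` that is not cyclic can make a
constituent of `π_f|_{G¹}` occur with Clifford multiplicity `e > 1`, and then `Hdg` has multiplicity `e`
on that packet (fallback: "`e` seeds for multiplicity `e`", the lever survives weakened); KMSW's
multiplicity formula for non-quasi-split inner forms with non-generic `ψ` is the unpublished half; CAP
shapes where the AJ character map is not injective. At `m = 0` it is Rogawski's multiplicity one for
`U(3)`. Size L–XL (paper mathematics until Matsushima / Arthur packets are typed).
Leans on (print): Mok Thm 2.5.2, KMSW, AMR, Marshall–Shin arXiv:1804.05047 (degree bookkeeping on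
`U(n,1)`), BMM Part 2 §1.8–1.9 + Thm 61, Shimura 1971 Ch. 3 (`ℋ(Γ, G(ℚ))` vs `ℋ_K`); tree:
`heckeCorrespondenceAction`, `levelProj_map_heckeCorrespondenceAction`, `IsRationalClass`. -/
theorem stub_multiplicityOne :
    ∀ (m : ℕ) (X : SchemeOver ℂ) (D : UnitaryBallQuotientDatum (2 * (m + 1)) X)
      (M : Submodule ℂ (complexBetti X (2 * (m + 1)))), IsSimplePiece m D M →
        ∀ a ∈ isotypicHull D M, IsRationalClass a →
          IsOfHodgeType (2 * (m + 1)) X (2 * (m + 1)) (m + 1) (m + 1) a → a ∈ M := by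
  sorry

/-- **Stub 4 — ONE SEED PER PURE PACKET (BET 1; the heart's non-vanishing).** For a simple piece `M` of
PURE type of the Hodge span of a `2n`-dimensional datum, the packet of `M` contains a non-zero RATIONAL
ALGEBRAIC class `a` (a `ℚ`-combination of cycle classes of codimension `n` with non-zero projection to
`⊕_τ H^{2n}[τπ_f]`). Why plausibly true: a pure packet carrying a rational `(n,n)`-line has, by Arthur's
multiplicity formula, a parameter `Ψ' ⊞ χ₀` with the character `χ₀` in the middle position at every real
place, hence parallel (triage X3; sibling line conjugate-dimension-sieve `IsTateType`), and for these
theta-type packets ONE of the following non-vanishings supplies `a`: (α) BMM's mechanism at the `a = 1`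
boundary of their Thm 72 — pole of `L^S(s, χ₀⁻¹ × π)` at `s = 1` (Jacquet–Shalika) ⟹ `θ_{V→W}(π) ≠ 0`
via the Rallis inner product formula in the second-term range (Gan–Qiu–Takeda arXiv:1207.4709 §1.7–1.10,
Thm 2; Yamana 2014), archimedean partner `A(n,n) ↔` the Kudla–Millson vector (A. Paul
doi:10.1006/jfan.1998.3330), and the Kudla–Millson class of the lift is a special-cycle class `[c(Wₙ)]`-type
(KudlaMillson1990; BMM Thm 69/71 seesaw, range-free) — i.e. the sibling line `definite-twin-theta` /
`stub_singletonSpan` of crux MiddleThetaSpan, of which only the NON-VANISHING OF ONE PROJECTION is needed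
here, not spanning; (β) a non-zero GGP period `∫_{c(W)} ω ≠ 0` of the packet against ONE special sub-ball
quotient of codimension `n` (then the projection of `[c(W)]` is `≠ 0`), or a non-zero restriction to a
special divisor followed by Noether–Lefschetz upstairs (cards ggp-staircase-special-level /
cup-period-bootstrap; triage X1: no `K`-type obstruction at `n = 2`, kit job j009990); (γ) at `m = 0`:
Lefschetz `(1,1)` (every class of `M` is a divisor class). It is implied by HC for the packet and, with
`stub_multiplicityOne` + the composition below, implies it (the amplification) — a genuine `∀ ↦ ∃!₁`
collapse, not a restatement. WHY IT MIGHT FAIL: a pure packet with `χ₀` parallel whose `A(n,n)`-member is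
NOT in the image of theta from any `U(n,n)` / `U(W)` at level `Γ` (ε-dichotomy at a non-split place, early
theta occurrence, or the PER-LEVEL problem R1 of the MiddleThetaSpan attack: the cycle realising the lift
lives on a deeper cover and its push-forward to level `Γ` projects to zero) AND invisible to every special
sub-ball period — then the packet's rational Hodge classes have no algebraic seed and HC fails there
(route kill criterion (i)/(iii)). Size XL (paper mathematics until cohomological representations and
theta lifts are typed). Leans on (print): arXiv:1306.1515 Thm 4, 61, 69, 71, 72, Props 80–81;
KudlaMillson1990 (doi:10.1007/bf02699880); arXiv:1207.4709; doi:10.1006/jfan.1998.3330; arXiv:1911.02783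
§3 (GGP relevance); tree: `specialCycleClasses_le_algebraicClasses`, `iSup_classesSupportedOn_le_algebraicClasses`,
`classesSupportedOn`, `UnitaryBallQuotientDatum.specialSubvariety`. -/
theorem stub_seedPerPacket :
    ∀ (m : ℕ) (X : SchemeOver ℂ) (D : UnitaryBallQuotientDatum (2 * (m + 1)) X)
      (M : Submodule ℂ (complexBetti X (2 * (m + 1)))), IsSimplePiece m D M → IsPureType m D M →
        ∃ a ∈ isotypicHull D M, IsRationalClass a ∧ a ∈ algebraicClasses X (m + 1) ∧ a ≠ 0 := by
  sorry

/-- **Stub 5 — CORE VANISHING (BET 2, the honest residue; HARDEST).** Every simple piece of the Hodge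
span of a `2n`-dimensional datum is of PURE type: a rational Hecke packet `⊕_τ H^{2n}[τπ_f]` some of whose
classes are not of type `(n,n)` carries NO non-zero rational `(n,n)`-class. Why plausibly true: (i) the
KILLED case — some `τπ_f` has no diagonal partner in degree `2n` at all — is FREE by the coefficient
sieve of the sibling line `conjugate-dimension-sieve` (`stub_sieve` (a): a rational class has a non-zero
component in every conjugate complex-isotypic piece, and Hecke projectors preserve type; provable now);
(ii) the genuine CORES — every `τπ_f` has the diagonal partner AND another partner in degree `2n`: a
constituent `Ψ_d`, `d ≥ 2`, of the parameter owns the middle `τ₁`-coordinate at every real place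
(triage-corrected list at `n = 2`: `Ψ₅` stable; `Ψ₄ ∋ 0` in 4+1; 3+2; 3+1+1; `Ψ₂ ∋ 0` in 2+2+1 / 2+1+1+1 /
3+2) — carry no rational `(n,n)`-line because the `T`-Hodge structure `N = (⊕_τ H[τπ_f])_ℚ` has `d`
distinct Hodge types in each embedding and is expected `T`-IRREDUCIBLE (Mumford–Tate side), the Galois
analogue — irreducibility of `r(Ψ_d)` — being known in the relevant ranks (3: Blasius–Rogawski; regular
algebraic `n ≤ 5`: Calegari–Gee arXiv:1104.4827, Xia arXiv:1708.00921; density one: Patrikis–Taylor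
arXiv:1307.1640); "Hodge ⟹ Tate" for these motives alone would finish it, and so would HC (a rational
Hodge line in a core would be a 'higher Blasius–Rogawski class' demanding a non-geodesic cycle, route crux
#5 HigherBlasiusRogawskiClass at `p = 5` — for EVEN `p = 2n` nobody predicts one). At `m = 0` it is the
Blasius–Rogawski theorem (impure endoscopic packets of Picard modular surfaces carry no rational
`(1,1)`-line). Partial tool: line `lefschetz-one-rank-down` (3+1+1 `Ψ₃`-cores). WHY IT MIGHT FAIL: ONE
rational `(2,2)`-class in ONE core packet of ONE compact `U(4,1)`-quotient (likeliest an EVEN core, 4+1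
with `Ψ₄ ∋ 0`, reached by no theta construction) refutes it — and then either HC fails there or a
non-geodesic cycle exists; tool-less today for `Ψ₅/Ψ₄/Ψ₂`-cores. Size: open-problem (XL+). Leans on
(print): Mok/KMSW multiplicity formula, AMR arXiv:1507.01432, Clozel (Ann Arbor) Thm 3.13, Kottwitz 1992 /
Kisin–Shin–Zhu arXiv:2110.05381, the irreducibility results above, zbl:0828.14012, Ichino–Prasanna
arXiv:1806.10563; tree: `IsOfHodgeType`, `HodgeModel`, `isotypicHull` (this file). -/
theorem stub_coreVanishing :
    ∀ (m : ℕ) (X : SchemeOver ℂ) (D : UnitaryBallQuotientDatum (2 * (m + 1)) X)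
      (M : Submodule ℂ (complexBetti X (2 * (m + 1)))), IsSimplePiece m D M → IsPureType m D M := by
  sorry

/-- **Stub 6 — cycle classes are absolute Hodge (KNOWN in print; tree-blocked).** On a smooth projective
complex variety every RATIONAL class of type `(p,p)` lying in the span of the algebraic cycle classes is
an absolute Hodge class (Deligne 1982, §2 Ex. 2.1(a); Charles–Schnell 2014, §11.2.2 after Def. 11.2.3:
"the cohomology class of an algebraic cycle is an absolute Hodge class"). VERBATIM the hypothesis
`CycleClassesAbsoluteHodge` of Disproof.lean §2 and the inline `hAH` of the landed
`Negative/HodgeImpliesAbsoluteHodge.lean` (so one proof serves all three, and the sibling line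
ggp-staircase-special-level's `AlgebraicClassesAbsoluteHodge` is its restriction to the family). Why
plausibly true: a theorem; `cl(Z)^σ = (2πi/σ(2πi))ᵖ cl(Z^σ)` because the cycle class is defined
algebraically (Chern classes / de Rham fundamental class) and conjugation of the variety conjugates the
cycle; rational combinations follow by `σ`-semilinearity (Disproof §8 `conjugates_add/_smul`). WHY IT IS
BLOCKED (Disproof §6–§8): any proof must construct, for every `σ ∈ Aut ℂ`, a `ConjugationChart σ X (2p)`
(Jouanolou torsor + GAGA `exists_isAnalytification` + de Rham's theorem + Grothendieck's algebraic de Rham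
comparison on the affine chart) and prove chart conjugation single-valued — none in the tree today; not
a truth risk. Size XL (infrastructure). Leans on: `IsAbsoluteHodgeClass`, `ConjugationChart`,
`IsConjugateClass`, `periodTwist`, `conjugateVariety`, `algebraicClasses`, Disproof §8 calculus
(`conjugates_add`, `conjugates_smul`, `isAbsoluteHodgeClass_smul_rat`). -/
theorem stub_cycleClassesAbsoluteHodge :
    ∀ ⦃n : ℕ⦄ ⦃X : SchemeOver ℂ⦄, IsSmoothProjective n X →
      ∀ (p : ℕ) (c : complexBetti X (2 * p)), IsRationalClass c → IsOfHodgeType n X (2 * p) p p c →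
        c ∈ algebraicClasses X p → IsAbsoluteHodgeClass n X p c := by
  sorry

/-! ## The composition (kernel-checked, no `sorry` of its own) -/

/-- The Hodge span is Hecke-stable (rationality: tree theorem; type: `stub_heckeCorrespondence` (i)). -/
theorem isHeckeStable_hodgeSpan (m : ℕ) (X : SchemeOver ℂ) (D : UnitaryBallQuotientDatum (2 * (m + 1)) X) :
    IsHeckeStable D (hodgeSpan m X) := by
  intro g
  unfold hodgeSpan
  refine (Submodule.map_span_le _ _ _).2 fun x hx => Submodule.subset_span ?_
  exact ⟨D.isRationalClass_heckeCorrespondenceAction _ g hx.1,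
    (stub_heckeCorrespondence _ X D g).1 _ _ _ x hx.2⟩

/-- **THE AMPLIFICATION.** A simple piece of pure type lies in the algebraic classes: its packet contains
a rational algebraic seed `a ≠ 0` (`stub_seedPerPacket`), of type `(n,n)` by purity, hence in the piece
(`stub_multiplicityOne`); the algebraic rational `(n,n)`-classes of the piece span a non-zero Hecke-stable
`ℚ`-defined subspace (`stub_heckeCorrespondence`), which by simplicity is the whole piece. -/
theorem piece_le_algebraicClasses (m : ℕ) (X : SchemeOver ℂ) (D : UnitaryBallQuotientDatum (2 * (m + 1)) X)
    (M : Submodule ℂ (complexBetti X (2 * (m + 1)))) (hM : IsSimplePiece m D M) (hP : IsPureType m D M) :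
    M ≤ algebraicClasses X (m + 1) := by
  -- the algebraic part of the piece
  let A : Submodule ℂ (complexBetti X (2 * (m + 1))) := Submodule.span ℂ
    {x | x ∈ M ∧ IsRationalClass x ∧ IsOfHodgeType (2 * (m + 1)) X (2 * (m + 1)) (m + 1) (m + 1) x ∧
      x ∈ algebraicClasses X (m + 1)}
  have hA_le : A ≤ M := Submodule.span_le.2 fun x hx => hx.1
  have hA_alg : A ≤ algebraicClasses X (m + 1) := Submodule.span_le.2 fun x hx => hx.2.2.2
  have hA_stable : IsHeckeStable D A := by
    intro g
    refine (Submodule.map_span_le _ _ _).2 fun x hx => Submodule.subset_span ?_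
    exact ⟨hM.2.2.1 g (Submodule.mem_map_of_mem hx.1),
      D.isRationalClass_heckeCorrespondenceAction _ g hx.2.1,
      (stub_heckeCorrespondence _ X D g).1 _ _ _ x hx.2.2.1,
      (stub_heckeCorrespondence _ X D g).2 (m + 1) (Submodule.mem_map_of_mem hx.2.2.2)⟩
  have hA_rat : IsRationalSubspace A :=
    Submodule.span_mono fun x hx => ⟨Submodule.subset_span hx, hx.2.1⟩
  -- the seed
  obtain ⟨a, ha, haQ, haAlg, ha0⟩ := stub_seedPerPacket m X D M hM hP
  have haH : IsOfHodgeType (2 * (m + 1)) X (2 * (m + 1)) (m + 1) (m + 1) a := hP a ha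
  have haM : a ∈ M := stub_multiplicityOne m X D M hM a ha haQ haH
  have haA : a ∈ A := Submodule.subset_span ⟨haM, haQ, haH, haAlg⟩
  -- simplicity: A = ⊥ or A = M, and the seed excludes ⊥
  rcases hM.2.2.2.2 A hA_le hA_stable hA_rat with h | h
  · exact absurd ((Submodule.mem_bot ℂ).1 (h ▸ haA)) ha0
  · exact h ▸ hA_alg

/-- **Middle-degree Hodge conjecture on the family, ALL levels `m` (Disproof's `MiddleHodge`), from the
stubs.** Let `S := span{rational (n,n) algebraic classes} ≤ Hdg`: Hecke-stable and `ℚ`-defined. If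
`S ≠ Hdg`, `stub_semisimple` yields a simple piece `M` with `M ⊓ S = ⊥`; it is pure
(`stub_coreVanishing`), hence algebraic (`piece_le_algebraicClasses`), hence `≤ S` — so `M = ⊥`,
contradicting simplicity. Therefore every rational `(n,n)`-class lies in `S ≤ algebraicClasses`. -/
theorem middleHodge_of_stubs (m : ℕ) (X : SchemeOver ℂ) (D : UnitaryBallQuotientDatum (2 * (m + 1)) X)
    (c : complexBetti X (2 * (m + 1))) (hc : IsRationalClass c)
    (hH : IsOfHodgeType (2 * (m + 1)) X (2 * (m + 1)) (m + 1) (m + 1) c) :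
    c ∈ algebraicClasses X (m + 1) := by
  let S : Submodule ℂ (complexBetti X (2 * (m + 1))) := Submodule.span ℂ
    {x | IsRationalClass x ∧ IsOfHodgeType (2 * (m + 1)) X (2 * (m + 1)) (m + 1) (m + 1) x ∧
      x ∈ algebraicClasses X (m + 1)}
  have hS_alg : S ≤ algebraicClasses X (m + 1) := Submodule.span_le.2 fun x hx => hx.2.2
  have hS_le : S ≤ hodgeSpan m X := Submodule.span_mono fun x hx => ⟨hx.1, hx.2.1⟩
  have hS_stable : IsHeckeStable D S := by
    intro g
    refine (Submodule.map_span_le _ _ _).2 fun x hx => Submodule.subset_span ?_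
    exact ⟨D.isRationalClass_heckeCorrespondenceAction _ g hx.1,
      (stub_heckeCorrespondence _ X D g).1 _ _ _ x hx.2.1,
      (stub_heckeCorrespondence _ X D g).2 (m + 1) (Submodule.mem_map_of_mem hx.2.2)⟩
  have hS_rat : IsRationalSubspace S :=
    Submodule.span_mono fun x hx => ⟨Submodule.subset_span hx, hx.1⟩
  have hS_eq : S = hodgeSpan m X := by
    by_contra hne
    obtain ⟨M, hM, hMS⟩ := stub_semisimple m X D S hS_le hS_stable hS_rat hne
    have hMalg : M ≤ algebraicClasses X (m + 1) :=
      piece_le_algebraicClasses m X D M hM (stub_coreVanishing m X D M hM)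
    -- `M` is spanned by its rational classes, which are rational, of type `(n,n)` (purity, through the
    -- packet `M ≤ isotypicHull M`) and algebraic — hence generators of `S`
    have hMS' : M ≤ S := by
      refine le_trans hM.2.2.2.1 (Submodule.span_le.2 fun x hx => ?_)
      have hxT : IsOfHodgeType (2 * (m + 1)) X (2 * (m + 1)) (m + 1) (m + 1) x :=
        stub_coreVanishing m X D M hM x (le_isotypicHull D M hx.1)
      exact Submodule.subset_span ⟨hx.2, hxT, hMalg hx.1⟩
    have hMle : M ≤ M ⊓ S := le_inf le_rfl hMS'
    rw [hMS, le_bot_iff] at hMle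
    exact hM.2.1 hMle
  have hcH : c ∈ hodgeSpan m X := mem_hodgeSpan hc hH
  rw [← hS_eq] at hcH
  exact hS_alg hcH

/-- **The crux from the stubs, BY NAME** (the route decl through rev 3; since rev 4 the verbatim local
copy above). Middle-degree HC on the family (`middleHodge_of_stubs`) and "cycle classes are absolute
Hodge" (`stub_cycleClassesAbsoluteHodge`) — Disproof §2's `of_middleHodge` shape, with the Hodge
conjecture on the family replaced by the amplification. -/
theorem BallQuotientHodgeAbsolute_of : BallQuotientHodgeAbsolute := by
  intro m X hD c hc hH
  obtain ⟨D⟩ := hD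
  exact stub_cycleClassesAbsoluteHodge D.isSmoothProjective (m + 1) c hc hH
    (middleHodge_of_stubs m X D c hc hH)

/-- **Corollary (transparency about strength, triage r1-1/r1-2: "C⁺ is stronger than the route target").**
The same stubs give the route TARGET `MiddleDegreeStep` outright (its sector bound and lower-degree
hypothesis unused): the line decides the sector, not only the hinge. Recorded so that a lead / the tenure
planner can re-cut the crux as `SeedPerPacket ∧ CoreVanishing` (card § Transfer) if this line is picked. -/
theorem middleDegreeStep_of_stubs : MiddleDegreeStep :=
  fun m X _ _ hD _ c hc hH => middleHodge_of_stubs m X hD.some c hc hH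

/-! ## Calibration at level `m = 0` (compact 2-ball quotients, degree 2; Disproof §3) -/

/-- **Stub 4 at level `0` is Lefschetz `(1,1)`** (proved modulo the tree's named fact
`lefschetzOneOne_rational`): a pure simple piece of `Hdg^{1,1}` of a compact ball-quotient surface is
`ℚ`-defined and non-zero, so it contains a non-zero RATIONAL class, of type `(1,1)` by purity, hence a
divisor class — the seed exists, inside the piece itself. (Stubs 3 and 5 at level `0` are Rogawski's
multiplicity one for `U(3)` and the Blasius–Rogawski theorem; not formalisable today.) -/
theorem seedPerPacket_level_zero (hL : lefschetzOneOne_rational) (X : SchemeOver ℂ)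
    (D : UnitaryBallQuotientDatum (2 * (0 + 1)) X) (M : Submodule ℂ (complexBetti X (2 * (0 + 1))))
    (hM : IsSimplePiece 0 D M) (hP : IsPureType 0 D M) :
    ∃ a ∈ isotypicHull D M, IsRationalClass a ∧ a ∈ algebraicClasses X (0 + 1) ∧ a ≠ 0 := by
  -- a non-zero rational class of the `ℚ`-defined non-zero `M`
  have hex : ∃ x ∈ M, IsRationalClass x ∧ x ≠ 0 := by
    by_contra h
    push Not at h
    refine hM.2.1 (le_bot_iff.1 (le_trans hM.2.2.2.1 (Submodule.span_le.2 ?_)))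
    rintro x ⟨hxM, hxQ⟩
    exact (Submodule.mem_bot ℂ).2 (h x hxM hxQ)
  obtain ⟨x, hxM, hxQ, hx0⟩ := hex
  have hxI : x ∈ isotypicHull D M := le_isotypicHull D M hxM
  exact ⟨x, hxI, hxQ, hL D.isSmoothProjective x hxQ (hP x hxI), hx0⟩

end Summit.HodgeConjecture.HodgeConjecture.Cruxes.BallQuotientHodgeAbsolute.HeckeSimpleSeedAmplification

end
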